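import Mathlib
import HarnessLib
import Summits.AtomisticToContinuum.FouriersLaw.Theses.JunctionLocality
import Summits.AtomisticToContinuum.FouriersLaw.Theorems.JunctionLocalitySuperadditiveResistanceDeviceLiouville
import Summits.AtomisticToContinuum.FouriersLaw.Theorems.JunctionLocalitySuperadditiveResistanceStubBypassBoundAux1

/-!
# Bypass-bound helpers II: the bypass pairing of the pinned chain in gradient form
(helpers `--supports` stmt-AtomisticToContinuum-11748 for stub `stub_bypassBound` of line
`floating-probe-bypass-laplacian`, crux `JunctionLocality.SuperadditiveResistance`)

For the pinned chain `P = pinnedChain ω₂ lam β γ` (`ω₂ > 0`, `lam, β ≥ 0`) and its Gibbs MEASURE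
`μ_T` (`T > 0`), the Gaussian integration by parts of Part I becomes, for every `g ∈ C¹` with
`g, ∂_{p_j} g ∈ L²(μ_T)` (the forward fields of the line have this regularity: `C²`, `L²`, finite
Dirichlet energy at every thermostatted site):

* `integral_mul_sq_sub_gibbsMeasure` — `⟨g, p_j² − T⟩_{μ_T} = T ⟨∂_{p_j} g, p_j⟩_{μ_T}`;
* `abs_integral_mul_sq_sub_gibbsMeasure_le` — `|⟨g, p_j² − T⟩_{μ_T}| ≤ T^{3/2} ‖∂_{p_j} g‖_{L²(μ_T)}`
  (Cauchy–Schwarz and equipartition `⟨p_j²⟩_{μ_T} = T`, `pinnedChain_integral_snd_sq`): the Kubo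
  pairing of ANY field with the source of bath `j` is controlled by the field's `p_j`-gradient alone —
  for the bypass `x = (γ²/T²)⟨g_0, p_{L−1}² − T⟩` this is `|x| ≤ γ² T^{-1/2} ‖∂_{p_{L−1}} g_0‖`, the
  "double escape" re-stated as smallness of the far-momentum sensitivity of the near forward field;
* `integral_mul_sq_sub_gibbsMeasure_eq_zero` — INVISIBILITY: `⟨F, p_j² − T⟩_{μ_T} = 0` for every
  `F ∈ L²(μ_T)` constant along the `p_j`-lines, in particular (`integral_comp_restrictLeft_mul_sq_sub`)
  for every observable `f ∘ π_N` of the left block against a right-block bath momentum: the bare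
  left block's own forward field contributes NOTHING to the bypass; only the junction-forced
  correction does (Part III).

Moment lemmas: `p_j, p_j² ∈ L²(μ_T)` (`pinnedChain_memLp_two_snd(_sq)`), from `e^{H/(2T)} ∈ L¹(μ_T)`.
-/

noncomputable section

open MeasureTheory Filter Topology
open scoped ContDiff
open Literature.MathematicalPhysics.KineticTheory.HeatConduction
open Summit.AtomisticToContinuum.FouriersLaw.Theorems.SuperadditiveResistance.DeviceLiouville
  (pinnedChain_sq_le_two_mul_hamiltonian)

namespace Summit.AtomisticToContinuum.FouriersLaw.Cruxes.SuperadditiveResistance.FloatingProbeBypassLaplacian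

section PinnedChain

variable {ω₂ lam β : ℝ} {L : ℕ}

/-- From `μ_T`-integrability to Lebesgue integrability against `e^{-H/T}` (pinned chain, `T > 0`).
[folklore] -/
theorem integrable_mul_gibbsDensity_of_integrable (hω : 0 < ω₂) (hl : 0 ≤ lam) (hβ : 0 ≤ β)
    (γ : ℝ) (L : ℕ) {T : ℝ} (hT : 0 < T) {F : PhaseSpace L → ℝ}
    (hF : Integrable F ((pinnedChain ω₂ lam β γ).gibbsMeasure L T)) :
    Integrable (fun x => F x * (pinnedChain ω₂ lam β γ).gibbsDensity L T x) := by
  have hρint : Integrable ((pinnedChain ω₂ lam β γ).gibbsDensity L T) :=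
    pinnedChain_integrable_gibbsDensity hω hl hβ γ L hT
  rw [OscillatorChain.gibbsMeasure_eq, integrable_tilted_iff hρint] at hF
  refine hF.congr (ae_of_all _ fun x => ?_)
  simp only [smul_eq_mul, OscillatorChain.exp_neg_hamiltonian_div]
  ring

/-- `p_j⁴ ≤ 32 T² e^{H/(2T)}` for the pinned chain (`p_j² ≤ 2H`, `s² ≤ 2e^s`). [folklore] -/
theorem pinnedChain_snd_pow_four_le (hω : 0 ≤ ω₂) (hl : 0 ≤ lam) (hβ : 0 ≤ β) (γ : ℝ) (L : ℕ)
    {T : ℝ} (hT : 0 < T) (j : Fin L) (x : PhaseSpace L) :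
    (x.2 j ^ 2) ^ 2 ≤
      32 * T ^ 2 * Real.exp (1 / (2 * T) * (pinnedChain ω₂ lam β γ).hamiltonian L x) := by
  have hH0 : 0 ≤ (pinnedChain ω₂ lam β γ).hamiltonian L x :=
    pinnedChain_hamiltonian_nonneg hω hl hβ γ L x
  have hp : x.2 j ^ 2 ≤ 2 * (pinnedChain ω₂ lam β γ).hamiltonian L x :=
    pinnedChain_sq_le_two_mul_hamiltonian hω hl hβ γ L x j
  set s : ℝ := 1 / (2 * T) * (pinnedChain ω₂ lam β γ).hamiltonian L x with hs
  have hs0 : 0 ≤ s := by positivity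
  have hexp : s ^ 2 ≤ 2 * Real.exp s := by
    have := Real.quadratic_le_exp_of_nonneg hs0
    nlinarith
  have hH : (pinnedChain ω₂ lam β γ).hamiltonian L x = 2 * T * s := by
    rw [hs]; field_simp
  have h1 : (x.2 j ^ 2) ^ 2 ≤ (2 * (pinnedChain ω₂ lam β γ).hamiltonian L x) ^ 2 :=
    pow_le_pow_left₀ (sq_nonneg _) hp 2
  rw [hH] at h1
  nlinarith [h1, hexp, sq_nonneg T]

/-- `p_j² ≤ 4 T e^{H/(2T)}` for the pinned chain. [folklore] -/
theorem pinnedChain_snd_sq_le (hω : 0 ≤ ω₂) (hl : 0 ≤ lam) (hβ : 0 ≤ β) (γ : ℝ) (L : ℕ)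
    {T : ℝ} (hT : 0 < T) (j : Fin L) (x : PhaseSpace L) :
    x.2 j ^ 2 ≤ 4 * T * Real.exp (1 / (2 * T) * (pinnedChain ω₂ lam β γ).hamiltonian L x) := by
  have hp : x.2 j ^ 2 ≤ 2 * (pinnedChain ω₂ lam β γ).hamiltonian L x :=
    pinnedChain_sq_le_two_mul_hamiltonian hω hl hβ γ L x j
  set s : ℝ := 1 / (2 * T) * (pinnedChain ω₂ lam β γ).hamiltonian L x with hs
  have hexp : s ≤ Real.exp s := by
    have := Real.add_one_le_exp s
    linarith
  have hH : (pinnedChain ω₂ lam β γ).hamiltonian L x = 2 * T * s := by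
    rw [hs]; field_simp
  rw [hH] at hp
  nlinarith [hexp, hT]

/-- `p_j² ∈ L²(μ_T)` for the pinned chain (`ω₂ > 0`, `lam, β ≥ 0`, `T > 0`). [folklore] -/
theorem pinnedChain_memLp_two_snd_sq (hω : 0 < ω₂) (hl : 0 ≤ lam) (hβ : 0 ≤ β) (γ : ℝ) (L : ℕ)
    {T : ℝ} (hT : 0 < T) (j : Fin L) :
    MemLp (fun x : PhaseSpace L => x.2 j ^ 2) 2 ((pinnedChain ω₂ lam β γ).gibbsMeasure L T) := by
  have hmeas : AEStronglyMeasurable (fun x : PhaseSpace L => x.2 j ^ 2)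
      ((pinnedChain ω₂ lam β γ).gibbsMeasure L T) :=
    (Continuous.aestronglyMeasurable (by fun_prop))
  rw [memLp_two_iff_integrable_sq hmeas]
  have hϑ : 1 / (2 * T) < 1 / T := by
    rw [one_div_lt_one_div (by positivity) hT]; linarith
  have hexp := pinnedChain_integrable_exp_mul_hamiltonian_gibbsMeasure hω hl hβ γ L hT hϑ
  refine (hexp.const_mul (32 * T ^ 2)).mono' (Continuous.aestronglyMeasurable (by fun_prop))
    (ae_of_all _ fun x => ?_)
  rw [Real.norm_eq_abs, abs_of_nonneg (sq_nonneg _)]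
  exact pinnedChain_snd_pow_four_le hω.le hl hβ γ L hT j x

/-- `p_j ∈ L²(μ_T)` for the pinned chain. [folklore] -/
theorem pinnedChain_memLp_two_snd (hω : 0 < ω₂) (hl : 0 ≤ lam) (hβ : 0 ≤ β) (γ : ℝ) (L : ℕ)
    {T : ℝ} (hT : 0 < T) (j : Fin L) :
    MemLp (fun x : PhaseSpace L => x.2 j) 2 ((pinnedChain ω₂ lam β γ).gibbsMeasure L T) := by
  have hmeas : AEStronglyMeasurable (fun x : PhaseSpace L => x.2 j)
      ((pinnedChain ω₂ lam β γ).gibbsMeasure L T) :=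
    (Continuous.aestronglyMeasurable (by fun_prop))
  rw [memLp_two_iff_integrable_sq hmeas]
  have hϑ : 1 / (2 * T) < 1 / T := by
    rw [one_div_lt_one_div (by positivity) hT]; linarith
  have hexp := pinnedChain_integrable_exp_mul_hamiltonian_gibbsMeasure hω hl hβ γ L hT hϑ
  refine (hexp.const_mul (4 * T)).mono' (Continuous.aestronglyMeasurable (by fun_prop))
    (ae_of_all _ fun x => ?_)
  rw [Real.norm_eq_abs, abs_of_nonneg (sq_nonneg _)]
  exact pinnedChain_snd_sq_le hω.le hl hβ γ L hT j x

/-- **Equipartition** `⟨p_j²⟩_{μ_T} = T` for the pinned chain. [folklore] -/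
theorem pinnedChain_integral_snd_sq (hω : 0 < ω₂) (hl : 0 ≤ lam) (hβ : 0 ≤ β) (γ : ℝ) (L : ℕ)
    {T : ℝ} (hT : 0 < T) (j : Fin L) :
    ∫ x, x.2 j ^ 2 ∂((pinnedChain ω₂ lam β γ).gibbsMeasure L T) = T := by
  haveI := pinnedChain_isProbabilityMeasure_gibbsMeasure hω hl hβ γ L hT
  have i2 : Integrable (fun x : PhaseSpace L => x.2 j ^ 2) ((pinnedChain ω₂ lam β γ).gibbsMeasure L T) :=
    (pinnedChain_memLp_two_snd hω hl hβ γ L hT j).integrable_sq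
  have i1 : Integrable (fun x : PhaseSpace L => x.2 j) ((pinnedChain ω₂ lam β γ).gibbsMeasure L T) :=
    (pinnedChain_memLp_two_snd hω hl hβ γ L hT j).integrable one_le_two
  have h0 := integral_sq_sub_mul_gibbsDensity (pinnedChain ω₂ lam β γ) hT.ne' j
    (pinnedChain_integrable_gibbsDensity hω hl hβ γ L hT)
    (integrable_mul_gibbsDensity_of_integrable hω hl hβ γ L hT i2)
    (integrable_mul_gibbsDensity_of_integrable hω hl hβ γ L hT i1)
  have h1 : ∫ x, (x.2 j ^ 2 - T) ∂((pinnedChain ω₂ lam β γ).gibbsMeasure L T) = 0 := by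
    rw [OscillatorChain.integral_gibbsMeasure, h0, mul_zero]
  rw [integral_sub i2 (integrable_const T), integral_const, smul_eq_mul, sub_eq_zero] at h1
  rw [h1]
  simp

/-- **The Kubo pairing with a bath source in gradient form (Gibbs measure).** For `g ∈ C¹` with
`g, ∂_{p_j} g ∈ L²(μ_T)`: `∫ g (p_j² − T) dμ_T = T ∫ ∂_{p_j} g · p_j dμ_T`. [folklore] -/
theorem integral_mul_sq_sub_gibbsMeasure (hω : 0 < ω₂) (hl : 0 ≤ lam) (hβ : 0 ≤ β) (γ : ℝ)
    (L : ℕ) {T : ℝ} (hT : 0 < T) (j : Fin L) {g : PhaseSpace L → ℝ} (hg : Differentiable ℝ g)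
    (hg2 : MemLp g 2 ((pinnedChain ω₂ lam β γ).gibbsMeasure L T))
    (hdg2 : MemLp (partialP j g) 2 ((pinnedChain ω₂ lam β γ).gibbsMeasure L T)) :
    ∫ x, g x * (x.2 j ^ 2 - T) ∂((pinnedChain ω₂ lam β γ).gibbsMeasure L T) =
      T * ∫ x, partialP j g x * x.2 j ∂((pinnedChain ω₂ lam β γ).gibbsMeasure L T) := by
  haveI := pinnedChain_isProbabilityMeasure_gibbsMeasure hω hl hβ γ L hT
  have hp := pinnedChain_memLp_two_snd hω hl hβ γ L hT j
  have hp2 := pinnedChain_memLp_two_snd_sq hω hl hβ γ L hT j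
  have i0 : Integrable g ((pinnedChain ω₂ lam β γ).gibbsMeasure L T) := hg2.integrable one_le_two
  have i1 : Integrable (fun x => g x * x.2 j) ((pinnedChain ω₂ lam β γ).gibbsMeasure L T) :=
    hg2.integrable_mul hp
  have i2 : Integrable (fun x => g x * x.2 j ^ 2) ((pinnedChain ω₂ lam β γ).gibbsMeasure L T) :=
    hg2.integrable_mul hp2
  have i3 : Integrable (fun x => partialP j g x * x.2 j) ((pinnedChain ω₂ lam β γ).gibbsMeasure L T) :=
    hdg2.integrable_mul hp
  have key := integral_mul_sq_sub_mul_gibbsDensity_of_differentiable (pinnedChain ω₂ lam β γ)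
    hT.ne' j hg (integrable_mul_gibbsDensity_of_integrable hω hl hβ γ L hT i0)
    ((integrable_mul_gibbsDensity_of_integrable hω hl hβ γ L hT i2).congr
      (ae_of_all _ fun x => by ring))
    (integrable_mul_gibbsDensity_of_integrable hω hl hβ γ L hT i1)
    (integrable_mul_gibbsDensity_of_integrable hω hl hβ γ L hT i3)
  rw [OscillatorChain.integral_gibbsMeasure, OscillatorChain.integral_gibbsMeasure, key]
  ring

/-- **The pairing is controlled by the `p_j`-gradient alone**:
`|∫ g (p_j² − T) dμ_T| ≤ T √T · √(∫ (∂_{p_j} g)² dμ_T)` (Cauchy–Schwarz + equipartition). For the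
bypass of the line, `|K_03| ≤ γ² T^{-1/2} ‖∂_{p_{L−1}} g_0‖_{L²(μ_T)}`. [folklore] -/
theorem abs_integral_mul_sq_sub_gibbsMeasure_le (hω : 0 < ω₂) (hl : 0 ≤ lam) (hβ : 0 ≤ β)
    (γ : ℝ) (L : ℕ) {T : ℝ} (hT : 0 < T) (j : Fin L) {g : PhaseSpace L → ℝ}
    (hg : Differentiable ℝ g) (hg2 : MemLp g 2 ((pinnedChain ω₂ lam β γ).gibbsMeasure L T))
    (hdg2 : MemLp (partialP j g) 2 ((pinnedChain ω₂ lam β γ).gibbsMeasure L T)) :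
    |∫ x, g x * (x.2 j ^ 2 - T) ∂((pinnedChain ω₂ lam β γ).gibbsMeasure L T)| ≤
      T * Real.sqrt T *
        Real.sqrt (∫ x, partialP j g x ^ 2 ∂((pinnedChain ω₂ lam β γ).gibbsMeasure L T)) := by
  rw [integral_mul_sq_sub_gibbsMeasure hω hl hβ γ L hT j hg hg2 hdg2, abs_mul, abs_of_pos hT]
  have hcs := abs_integral_mul_le hdg2 (pinnedChain_memLp_two_snd hω hl hβ γ L hT j)
  rw [pinnedChain_integral_snd_sq hω hl hβ γ L hT j] at hcs
  have hT0 : 0 ≤ T := hT.le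
  calc T * |∫ x, partialP j g x * x.2 j ∂((pinnedChain ω₂ lam β γ).gibbsMeasure L T)|
      ≤ T * (Real.sqrt (∫ x, partialP j g x ^ 2 ∂((pinnedChain ω₂ lam β γ).gibbsMeasure L T)) *
          Real.sqrt T) := mul_le_mul_of_nonneg_left hcs hT0
    _ = T * Real.sqrt T *
        Real.sqrt (∫ x, partialP j g x ^ 2 ∂((pinnedChain ω₂ lam β γ).gibbsMeasure L T)) := by ring

/-- **Invisibility (Gibbs measure).** An `L²(μ_T)` observable that does not depend on `p_j` is
orthogonal to the source `p_j² − T` of the bath at `j`. [folklore] -/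
theorem integral_mul_sq_sub_gibbsMeasure_eq_zero (hω : 0 < ω₂) (hl : 0 ≤ lam) (hβ : 0 ≤ β)
    (γ : ℝ) (L : ℕ) {T : ℝ} (hT : 0 < T) (j : Fin L) {F : PhaseSpace L → ℝ}
    (hF : ∀ (x : PhaseSpace L) (t : ℝ), F (x + t • ((0, Pi.single j 1) : PhaseSpace L)) = F x)
    (hF2 : MemLp F 2 ((pinnedChain ω₂ lam β γ).gibbsMeasure L T)) :
    ∫ x, F x * (x.2 j ^ 2 - T) ∂((pinnedChain ω₂ lam β γ).gibbsMeasure L T) = 0 := by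
  haveI := pinnedChain_isProbabilityMeasure_gibbsMeasure hω hl hβ γ L hT
  have hp := pinnedChain_memLp_two_snd hω hl hβ γ L hT j
  have hp2 := pinnedChain_memLp_two_snd_sq hω hl hβ γ L hT j
  have i0 : Integrable F ((pinnedChain ω₂ lam β γ).gibbsMeasure L T) := hF2.integrable one_le_two
  have i1 : Integrable (fun x => F x * x.2 j) ((pinnedChain ω₂ lam β γ).gibbsMeasure L T) :=
    hF2.integrable_mul hp
  have i2 : Integrable (fun x => F x * x.2 j ^ 2) ((pinnedChain ω₂ lam β γ).gibbsMeasure L T) :=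
    hF2.integrable_mul hp2
  have key := integral_mul_sq_sub_mul_gibbsDensity_eq_zero (pinnedChain ω₂ lam β γ) hT.ne' j hF
    (integrable_mul_gibbsDensity_of_integrable hω hl hβ γ L hT i0)
    ((integrable_mul_gibbsDensity_of_integrable hω hl hβ γ L hT i2).congr
      (ae_of_all _ fun x => by ring))
    (integrable_mul_gibbsDensity_of_integrable hω hl hβ γ L hT i1)
  rw [OscillatorChain.integral_gibbsMeasure, key, mul_zero]

end PinnedChain

/-! ## Left-block observables against the right bath -/

section Blocks

variable {ω₂ lam β : ℝ} {N M : ℕ}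

/-- Moving along a right-block momentum direction does not change the left-block coordinates. -/
theorem restrictLeft_add_smul_natAdd (k : Fin M) (x : PhaseSpace (N + M)) (t : ℝ) :
    (fun y : PhaseSpace (N + M) => ((y.1 ∘ Fin.castAdd M, y.2 ∘ Fin.castAdd M) : PhaseSpace N))
        (x + t • ((0, Pi.single (Fin.natAdd N k) 1) : PhaseSpace (N + M))) =
      (x.1 ∘ Fin.castAdd M, x.2 ∘ Fin.castAdd M) := by
  have hne : ∀ i : Fin N, Fin.castAdd M i ≠ Fin.natAdd N k := by
    intro i h
    have := congrArg Fin.val h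
    simp at this
    omega
  ext i
  · simp
  · simp [hne i]

/-- **Left-block observables are invisible to the right-block baths.** For the pinned chain's
Gibbs state on `N + M` sites and any `f : PhaseSpace N → ℝ` with `f ∘ π_N ∈ L²(μ_T)`:
`∫ (f ∘ π_N) (p_{N+k}² − T) dμ_T = 0`. In the line's device (`k = M − 1`, the right bath): the
bare left block's forward field, lifted to the device, has ZERO bypass pairing — the bypass
conductance is carried entirely by the junction-forced correction `g_0 − g_0^{(N)} ∘ π_N`.
[folklore] -/
theorem integral_comp_restrictLeft_mul_sq_sub (hω : 0 < ω₂) (hl : 0 ≤ lam) (hβ : 0 ≤ β) (γ : ℝ)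
    {T : ℝ} (hT : 0 < T) (k : Fin M) {f : PhaseSpace N → ℝ}
    (hf : MemLp (f ∘ fun y : PhaseSpace (N + M) => ((y.1 ∘ Fin.castAdd M, y.2 ∘ Fin.castAdd M) :
      PhaseSpace N)) 2 ((pinnedChain ω₂ lam β γ).gibbsMeasure (N + M) T)) :
    ∫ x, (f ∘ fun y : PhaseSpace (N + M) =>
        ((y.1 ∘ Fin.castAdd M, y.2 ∘ Fin.castAdd M) : PhaseSpace N)) x *
          (x.2 (Fin.natAdd N k) ^ 2 - T) ∂((pinnedChain ω₂ lam β γ).gibbsMeasure (N + M) T) = 0 := by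
  exact integral_mul_sq_sub_gibbsMeasure_eq_zero hω hl hβ γ (N + M) hT (Fin.natAdd N k)
    (fun x t => congrArg f (restrictLeft_add_smul_natAdd k x t)) hf

/-- Registered helper sub-goal `helper_bypassPairingGradient` of stub `stub_bypassBound`
(= `abs_integral_mul_sq_sub_gibbsMeasure_le` in stub form): the Kubo pairing of a field with a bath
source is bounded by `T^{3/2}` times the `L²(μ_T)` norm of the field's gradient in that bath's
momentum. [folklore] -/
theorem helper_bypassPairingGradient : ∀ {ω₂ lam β : ℝ}, 0 < ω₂ → 0 ≤ lam → 0 ≤ β → ∀ (γ : ℝ) (L : ℕ) {T : ℝ}, 0 < T → ∀ (j : Fin L) {g : PhaseSpace L → ℝ}, Differentiable ℝ g → MemLp g 2 ((pinnedChain ω₂ lam β γ).gibbsMeasure L T) → MemLp (partialP j g) 2 ((pinnedChain ω₂ lam β γ).gibbsMeasure L T) → |∫ x, g x * (x.2 j ^ 2 - T) ∂((pinnedChain ω₂ lam β γ).gibbsMeasure L T)| ≤ T * Real.sqrt T * Real.sqrt (∫ x, partialP j g x ^ 2 ∂((pinnedChain ω₂ lam β γ).gibbsMeasure L T)) :=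
  fun hω hl hβ γ L _ hT j _ hg hg2 hdg2 =>
    abs_integral_mul_sq_sub_gibbsMeasure_le hω hl hβ γ L hT j hg hg2 hdg2

end Blocks

end Summit.AtomisticToContinuum.FouriersLaw.Cruxes.SuperadditiveResistance.FloatingProbeBypassLaplacian

end
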